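import Mathlib
import Summits.RiemannHypothesis.RiemannHypothesis.Theorems.SoloInformedScrewVerified
import Literature.NumberTheory.LFunctions.FordZetaZeroRecipSqSum
import HarnessLib

/-!
# T44 — Visibility of an off-line zero in Suzuki's `Ψ`, and its price in cleanliness

T43 (`zetaScrew_ge_neg_of_rhUpTo`) is the RH-blind half of Suzuki's criterion
`RH ↔ Ψ ≥ 0` with its exchange rate (verification to height `T₀` ⟹ `Ψ(t) ≥ −τ` for
`t ≲ 2 log T₀ − 2 log log T₀`). This file is the CONVERSE bookkeeping: when does a hypothetical
off-line zero `ρ₀ = 1/2 + η + iγ₀` (`η > 0`) become visible as `Ψ(t) < 0`, and what must be known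
about the OTHER zeros for that to be certified?

At the resonant windows `t_k = 2πk/γ₀` the quartet `1/2 ± η ± iγ₀` contributes exactly
`m·(cosh(η t_k) − 1)(η² − γ₀²)/(η² + γ₀²)² < 0` per zero (`screwTerm_re_eq_quartet`); a zero on
the line contributes `≤ 2m/γ²` (`screwTerm_re_le_of_re_eq_half`); an arbitrary zero of the strip
contributes `≤ m(1 + cosh(t/2))/γ²` (`screwTerm_re_le`). Hence (T44,
`zetaScrew_le_of_rhUpToExcept`):
if every zero with `|Im ρ| ≤ H` is on the line or in the quartet (`RHUpToExcept H η γ₀`), then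

  `Ψ(t_k) ≤ −(cosh(η t_k) − 1)(γ₀² − η²)/(γ₀² + η²)² + 128·C₀·log 16/15`
  `        + (1 + cosh(t_k/2))·64·C₀·log(H + 2)/(H + 1)`.

READING. (i) Lone quartet (`H = ∞`, `zetaScrew_le_of_lone_quartet`,
`exists_zetaScrew_neg_of_lone_quartet`): `Ψ(t_k) < 0` as soon as
`cosh(η t_k) ≳ 24·C₀·γ₀²`, i.e. from `t ≈ η⁻¹·log(48·C₀·γ₀²) = (2/η)(log γ₀ + O(1))` on — the
single-log visibility rate matching T43. (ii) The PRICE: the last term is harmless only if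
`H/log H ≳ 64·C₀·γ₀²·cosh(t_k/2)/cosh(η t_k) ≍ γ₀^{1/η}` — to SEE an off-line zero of offset `η`
at height `γ₀` through `Ψ` one must already control every zero up to height `≈ γ₀^{1/η}`
(e.g. `η = 0.1`, `γ₀ = 10¹³`: `H ≈ 10¹³⁰`), against a polylogarithmic window / bounded cluster
around `γ₀` for the Weil ground energy (T16–T18, T30–T34, T40): `Ψ` cannot localise in height, so
its witnessing of a violation is hostage to all zeros below `e^{t/2}` (whence no rate in Suzuki's
Thm 1.7, proved via Landau's theorem).
-/

noncomputable section

open scoped Real Topology ComplexConjugate BigOperators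
open Complex Filter Set Literature.NumberTheory.LFunctions

namespace Summit.RiemannHypothesis.RiemannHypothesis.Theorems

/-- `RHUpToExcept H η γ₀`: every zero of `ζ` in the open strip with `|Im ρ| ≤ H` lies on the
critical line or at one of the four points `1/2 ± η ± iγ₀`. -/
def RHUpToExcept (H η γ₀ : ℝ) : Prop :=
  ∀ ρ : ℂ, riemannZeta ρ = 0 → 0 < ρ.re → ρ.re < 1 → |ρ.im| ≤ H →
    ρ.re = 1 / 2 ∨ (|ρ.re - 1 / 2| = η ∧ |ρ.im| = |γ₀|)

/-- `RHUpTo H` is the case of an empty exception. -/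
theorem rhUpToExcept_of_rhUpTo {H : ℝ} (h : RHUpTo H) (η γ₀ : ℝ) : RHUpToExcept H η γ₀ :=
  fun _ hζ h0 h1 hH ↦ Or.inl (h.re_eq hζ (im_ne_zero_of_riemannZeta_eq_zero hζ h0 h1) hH)

/-- `cosh z` is real at `Im z ∈ 2πℤ`: `cosh(x + 2πk·i) = cosh x`. -/
theorem ccosh_eq_cosh_re_of_im {z : ℂ} {k : ℤ} (hz : z.im = k * (2 * π)) :
    Complex.cosh z = (Real.cosh z.re : ℂ) := by
  have e : z = (z.re : ℂ) + ((z.im : ℝ) : ℂ) * I := (Complex.re_add_im z).symm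
  have hc : Complex.cos ((z.im : ℝ) : ℂ) = 1 := by
    have h := (Complex.cos_periodic.int_mul k) 0
    rw [zero_add, Complex.cos_zero] at h
    rw [hz]; push_cast; exact h
  have hs : Complex.sin ((z.im : ℝ) : ℂ) = 0 := by
    have h := (Complex.sin_periodic.int_mul k) 0
    rw [zero_add, Complex.sin_zero] at h
    rw [hz]; push_cast; exact h
  rw [e, Complex.cosh_add, Complex.cosh_mul_I, Complex.sinh_mul_I, hc, hs, zero_mul, mul_zero,
    add_zero, mul_one, Complex.ofReal_cosh]
  simp

/-- `Re(1/z²) = (Re z² − Im z²)/(Re z² + Im z²)²`. -/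
theorem one_div_sq_re (z : ℂ) :
    (1 / z ^ 2).re = (z.re ^ 2 - z.im ^ 2) / (z.re ^ 2 + z.im ^ 2) ^ 2 := by
  rw [one_div, pow_two, Complex.inv_re, Complex.normSq_mul, Complex.mul_re, Complex.normSq_apply]
  ring

/-- **Exact value of the summand at a resonance** `Im ρ · t ∈ 2πℤ`:
`Re screwTerm = m·(cosh(σ't) − 1)(σ'² − γ²)/(σ'² + γ²)²`, `σ' = Re ρ − 1/2`, `γ = Im ρ`. -/
theorem screwTerm_re_eq_of_resonance {ρ : ℂ} {t : ℝ} {k : ℤ} (hk : ρ.im * t = k * (2 * π)) :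
    (screwTerm t ρ).re = (riemannZetaZeroOrder ρ : ℝ) *
      ((Real.cosh ((ρ.re - 1 / 2) * t) - 1) *
        (((ρ.re - 1 / 2) ^ 2 - ρ.im ^ 2) / ((ρ.re - 1 / 2) ^ 2 + ρ.im ^ 2) ^ 2)) := by
  have him : ((ρ - 1 / 2) * t).im = k * (2 * π) := by simp [hk]
  have hre : ((ρ - 1 / 2) * t).re = (ρ.re - 1 / 2) * t := by simp
  have hcosh := ccosh_eq_cosh_re_of_im him
  rw [hre] at hcosh
  have hval : screwTerm t ρ = (((riemannZetaZeroOrder ρ : ℝ)) : ℂ) *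
      ((((Real.cosh ((ρ.re - 1 / 2) * t) - 1 : ℝ)) : ℂ) * (1 / (ρ - 1 / 2) ^ 2)) := by
    rw [screwTerm, hcosh]; push_cast; ring
  rw [hval, Complex.re_ofReal_mul, Complex.re_ofReal_mul, one_div_sq_re]
  simp

/-- **At a quartet position** (`|Re ρ − 1/2| = η`, `|Im ρ| = |γ₀|`) and a resonant window
(`γ₀ t ∈ 2πℤ`): `Re screwTerm = m·(cosh(ηt) − 1)(η² − γ₀²)/(η² + γ₀²)²`. -/
theorem screwTerm_re_eq_quartet {ρ : ℂ} {η γ₀ t : ℝ} {k : ℤ} (hre : |ρ.re - 1 / 2| = η)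
    (him : |ρ.im| = |γ₀|) (hk : γ₀ * t = k * (2 * π)) :
    (screwTerm t ρ).re = (riemannZetaZeroOrder ρ : ℝ) *
      ((Real.cosh (η * t) - 1) * ((η ^ 2 - γ₀ ^ 2) / (η ^ 2 + γ₀ ^ 2) ^ 2)) := by
  have hk' : ∃ k' : ℤ, ρ.im * t = k' * (2 * π) := by
    rcases abs_eq_abs.1 him with h | h
    · exact ⟨k, by rw [h, hk]⟩
    · exact ⟨-k, by rw [h, neg_mul, hk]; push_cast; ring⟩
  obtain ⟨k', hk'⟩ := hk'
  rw [screwTerm_re_eq_of_resonance hk']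
  have hη0 : 0 ≤ η := hre ▸ abs_nonneg _
  have h1 : (ρ.re - 1 / 2) ^ 2 = η ^ 2 := by rw [← hre, sq_abs]
  have h2 : ρ.im ^ 2 = γ₀ ^ 2 := by rw [← sq_abs, him, sq_abs]
  have h3 : Real.cosh ((ρ.re - 1 / 2) * t) = Real.cosh (η * t) := by
    rw [← Real.cosh_abs, abs_mul, hre, ← Real.cosh_abs (η * t), abs_mul, abs_of_nonneg hη0]
  rw [h1, h2, h3]

/-- The quartet value is `≤ 0` (`η² ≤ γ₀²`). -/
theorem screwTerm_re_quartet_nonpos {ρ : ℂ} {η γ₀ t : ℝ} {k : ℤ} (hre : |ρ.re - 1 / 2| = η)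
    (him : |ρ.im| = |γ₀|) (hk : γ₀ * t = k * (2 * π)) (hηγ : η ^ 2 ≤ γ₀ ^ 2)
    (hm : 0 ≤ riemannZetaZeroOrder ρ) : (screwTerm t ρ).re ≤ 0 := by
  rw [screwTerm_re_eq_quartet hre him hk]
  have hm' : (0 : ℝ) ≤ riemannZetaZeroOrder ρ := by exact_mod_cast hm
  have hc : 0 ≤ Real.cosh (η * t) - 1 := by linarith [Real.one_le_cosh (η * t)]
  have hd : (η ^ 2 - γ₀ ^ 2) / (η ^ 2 + γ₀ ^ 2) ^ 2 ≤ 0 :=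
    div_nonpos_of_nonpos_of_nonneg (by linarith) (by positivity)
  exact mul_nonpos_of_nonneg_of_nonpos hm' (mul_nonpos_of_nonneg_of_nonpos hc hd)

/-- **Norm of the summand in the strip**: `‖screwTerm t ρ‖ ≤ m(1 + cosh(t/2))/(Im ρ)²`
(`0 ≤ Re ρ ≤ 1`). -/
theorem norm_screwTerm_le {ρ : ℂ} (h0 : 0 ≤ ρ.re) (h1 : ρ.re ≤ 1) (him : ρ.im ≠ 0)
    (hm : 0 ≤ riemannZetaZeroOrder ρ) (t : ℝ) :
    ‖screwTerm t ρ‖ ≤ (riemannZetaZeroOrder ρ : ℝ) * ((1 + Real.cosh (t / 2)) / ρ.im ^ 2) := by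
  have hm' : (0 : ℝ) ≤ riemannZetaZeroOrder ρ := by exact_mod_cast hm
  rw [screwTerm, norm_mul]
  have hnm : ‖(riemannZetaZeroOrder ρ : ℂ)‖ = (riemannZetaZeroOrder ρ : ℝ) := by
    rw [← Complex.ofReal_intCast, Complex.norm_real, Real.norm_eq_abs, abs_of_nonneg hm']
  rw [hnm]
  refine mul_le_mul_of_nonneg_left ?_ hm'
  rw [norm_div, norm_pow]
  have hnum : ‖Complex.cosh ((ρ - 1 / 2) * t) - 1‖ ≤ 1 + Real.cosh (t / 2) := by
    have hre : ((ρ - 1 / 2) * t).re = (ρ.re - 1 / 2) * t := by simp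
    have hc : Real.cosh (((ρ - 1 / 2) * t).re) ≤ Real.cosh (t / 2) := by
      rw [hre, Real.cosh_le_cosh, abs_mul]
      have : |ρ.re - 1 / 2| ≤ 1 / 2 := abs_le.2 ⟨by linarith, by linarith⟩
      calc |ρ.re - 1 / 2| * |t| ≤ 1 / 2 * |t| := by gcongr
        _ = |t / 2| := by rw [abs_div]; norm_num; ring
    calc ‖Complex.cosh ((ρ - 1 / 2) * t) - 1‖
        ≤ ‖Complex.cosh ((ρ - 1 / 2) * t)‖ + ‖(1 : ℂ)‖ := norm_sub_le _ _
      _ ≤ Real.cosh (t / 2) + 1 := by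
          rw [norm_one]; exact add_le_add
            ((Literature.Barriers.RiemannHypothesis.norm_ccosh_le_cosh_re _).trans hc) le_rfl
      _ = 1 + Real.cosh (t / 2) := add_comm _ _
  have hden : ρ.im ^ 2 ≤ ‖ρ - 1 / 2‖ ^ 2 := by
    have h := Complex.abs_im_le_norm (ρ - 1 / 2)
    have e : (ρ - 1 / 2).im = ρ.im := by simp
    rw [e] at h
    nlinarith [abs_nonneg ρ.im, sq_abs ρ.im]
  have hden0 : 0 < ρ.im ^ 2 := by positivity
  calc ‖Complex.cosh ((ρ - 1 / 2) * t) - 1‖ / ‖ρ - 1 / 2‖ ^ 2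
      ≤ (1 + Real.cosh (t / 2)) / ‖ρ - 1 / 2‖ ^ 2 := by gcongr
    _ ≤ (1 + Real.cosh (t / 2)) / ρ.im ^ 2 := by
        apply div_le_div_of_nonneg_left (by positivity) hden0 hden

/-- Upper bound in the strip: `Re screwTerm ≤ m(1 + cosh(t/2))/(Im ρ)²`. -/
theorem screwTerm_re_le {ρ : ℂ} (h0 : 0 ≤ ρ.re) (h1 : ρ.re ≤ 1) (him : ρ.im ≠ 0)
    (hm : 0 ≤ riemannZetaZeroOrder ρ) (t : ℝ) :
    (screwTerm t ρ).re ≤ (riemannZetaZeroOrder ρ : ℝ) * ((1 + Real.cosh (t / 2)) / ρ.im ^ 2) :=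
  (Complex.re_le_norm _).trans (norm_screwTerm_le h0 h1 him hm t)

/-- **On the line**: `Re screwTerm = m(1 − cos γt)/γ² ≤ 2m/γ²`. -/
theorem screwTerm_re_le_of_re_eq_half {ρ : ℂ} (hre : ρ.re = 1 / 2) (him : ρ.im ≠ 0)
    (hm : 0 ≤ riemannZetaZeroOrder ρ) (t : ℝ) :
    (screwTerm t ρ).re ≤ (riemannZetaZeroOrder ρ : ℝ) * (2 / ρ.im ^ 2) := by
  have eρ : ρ - 1 / 2 = (ρ.im : ℂ) * I := by
    apply Complex.ext <;> simp [hre]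
  have hcosh : Complex.cosh ((ρ - 1 / 2) * t) = (Real.cos (ρ.im * t) : ℂ) := by
    rw [eρ, show (ρ.im : ℂ) * I * t = ((ρ.im * t : ℝ) : ℂ) * I by push_cast; ring,
      Complex.cosh_mul_I, ← Complex.ofReal_cos]
  have hsq : (ρ - 1 / 2) ^ 2 = ((-(ρ.im ^ 2) : ℝ) : ℂ) := by
    rw [eρ]; push_cast; rw [mul_pow, Complex.I_sq]; ring
  have hval : screwTerm t ρ = (((riemannZetaZeroOrder ρ : ℝ) *
      ((Real.cos (ρ.im * t) - 1) / (-(ρ.im ^ 2)))) : ℝ) := by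
    rw [screwTerm, hcosh, hsq]; push_cast; ring
  rw [hval, Complex.ofReal_re]
  have hm' : (0 : ℝ) ≤ riemannZetaZeroOrder ρ := by exact_mod_cast hm
  apply mul_le_mul_of_nonneg_left _ hm'
  have hy2 : 0 < ρ.im ^ 2 := by positivity
  rw [div_neg, ← neg_div, neg_sub, div_le_div_iff_of_pos_right hy2]
  linarith [Real.neg_one_le_cos (ρ.im * t)]

/-- **T44 (visibility of an off-line zero in `Ψ`, with the cleanliness price).**
Let `ρ₀ = 1/2 + η + iγ₀` be a zero of `ζ` with `η > 0`, and suppose every zero with `|Im ρ| ≤ H`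
(`H ≥ |γ₀|`) is on the line or in the quartet `1/2 ± η ± iγ₀`. Then at every resonant window
`t = 2πk/γ₀`:
`Ψ(t) ≤ −(cosh(ηt) − 1)(γ₀² − η²)/(γ₀² + η²)² + 128·C₀·log 16/15`
`       + (1 + cosh(t/2))·64·C₀·log(H+2)/(H+1)`. -/
theorem zetaScrew_le_of_rhUpToExcept (hS : Suzuki2023_thm11_series) {C₀ : ℝ} (hC₀ : 0 ≤ C₀)
    (hW : ∀ u : ℝ, (zetaZeroCount (u + 1) : ℝ) - zetaZeroCount u ≤ C₀ * Real.log (|u| + 2))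
    {ρ₀ : ℂ} {η H : ℝ} (hζ : riemannZeta ρ₀ = 0) (hρ₀ : ρ₀.re = 1 / 2 + η) (hη : 0 < η)
    (hH : |ρ₀.im| ≤ H) (hclean : RHUpToExcept H η ρ₀.im) (k : ℤ) :
    zetaScrew (2 * π * k / ρ₀.im) ≤
      -((Real.cosh (η * (2 * π * k / ρ₀.im)) - 1) *
          ((ρ₀.im ^ 2 - η ^ 2) / (ρ₀.im ^ 2 + η ^ 2) ^ 2))
        + 128 * C₀ * Real.log (14 + 2) / (14 + 1)
        + (1 + Real.cosh (2 * π * k / ρ₀.im / 2)) * (64 * C₀ * Real.log (H + 2) / (H + 1)) := by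
  classical
  set t : ℝ := 2 * π * k / ρ₀.im with ht
  -- `ρ₀` is a non-trivial zero: `|γ₀| > 14`, `m₀ ≥ 1`, `η < 1/2`
  have hmem₀ : ρ₀ ∈ ZetaZeros.riemannZetaNontrivialZeros :=
    ZetaZeros.riemannZetaNontrivialZeros.mem_of_re_pos hζ (by rw [hρ₀]; linarith)
  have h14 : 14 < |ρ₀.im| := FordL33.fourteen_lt_abs_im ⟨ρ₀, hmem₀⟩
  have hγne : ρ₀.im ≠ 0 := by intro h; rw [h, abs_zero] at h14; linarith
  have hre1 : ρ₀.re < 1 := ZetaZeros.riemannZetaNontrivialZeros.re_lt_one hmem₀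
  have hη1 : η < 1 / 2 := by linarith
  have hηγ : η ^ 2 ≤ ρ₀.im ^ 2 := by
    rw [← sq_abs ρ₀.im]; exact pow_le_pow_left₀ hη.le (by linarith) 2
  have hm₀ : (1 : ℝ) ≤ riemannZetaZeroOrder ρ₀ := by
    exact_mod_cast ZetaZeros.riemannZetaNontrivialZeros.one_le_order hmem₀
  have hH1 : 1 ≤ H := by linarith
  have hres : ρ₀.im * t = k * (2 * π) := by rw [ht]; field_simp; try ring
  have habs₀ : |ρ₀.re - 1 / 2| = η := by rw [hρ₀, add_sub_cancel_left, abs_of_pos hη]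
  -- constants
  set K : ℝ := 1 + Real.cosh (t / 2) with hK
  have hK0 : 0 ≤ K := by positivity
  obtain ⟨hsum14, htsum14⟩ := summable_screwTailWeight hC₀ hW (T₀ := 14) (by norm_num)
  obtain ⟨hsumH, htsumH⟩ := summable_screwTailWeight hC₀ hW hH1
  set S₁ : ℝ := ∑' ρ : ZetaZeros.riemannZetaNontrivialZeros,
    (riemannZetaZeroOrder (ρ : ℂ) : ℝ) * screwTailWeight 14 (ρ : ℂ).im with hS₁
  set S₂ : ℝ := ∑' ρ : ZetaZeros.riemannZetaNontrivialZeros,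
    (riemannZetaZeroOrder (ρ : ℂ) : ℝ) * screwTailWeight H (ρ : ℂ).im with hS₂
  set F : ℝ := (Real.cosh (η * t) - 1) * ((η ^ 2 - ρ₀.im ^ 2) / (η ^ 2 + ρ₀.im ^ 2) ^ 2) with hF
  set E₀ : ℝ := (riemannZetaZeroOrder ρ₀ : ℝ) * F with hE₀
  let r₀ : ZetaZeros.riemannZetaNontrivialZeros := ⟨ρ₀, hmem₀⟩
  -- Suzuki's series, real parts
  have h1 : HasSum (fun ρ : ZetaZeros.riemannZetaNontrivialZeros ↦ (screwTerm t ρ).re)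
      (zetaScrew t) := by
    have h := (hS t).mapL Complex.reCLM
    simpa [screwTerm] using h
  -- the majorant
  have h2 : HasSum (fun ρ : ZetaZeros.riemannZetaNontrivialZeros ↦
      2 * ((riemannZetaZeroOrder (ρ : ℂ) : ℝ) * screwTailWeight 14 (ρ : ℂ).im) +
        K * ((riemannZetaZeroOrder (ρ : ℂ) : ℝ) * screwTailWeight H (ρ : ℂ).im) +
        (if ρ = r₀ then E₀ else 0)) (2 * S₁ + K * S₂ + E₀) :=
    ((hsum14.hasSum.mul_left 2).add (hsumH.hasSum.mul_left K)).add (hasSum_ite_eq r₀ E₀)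
  -- pointwise comparison
  have hpt : ∀ ρ : ZetaZeros.riemannZetaNontrivialZeros, (screwTerm t ρ).re ≤
      2 * ((riemannZetaZeroOrder (ρ : ℂ) : ℝ) * screwTailWeight 14 (ρ : ℂ).im) +
        K * ((riemannZetaZeroOrder (ρ : ℂ) : ℝ) * screwTailWeight H (ρ : ℂ).im) +
        (if ρ = r₀ then E₀ else 0) := by
    intro ρ
    have hz := ZetaZeros.riemannZetaNontrivialZeros.zeta_eq_zero ρ.2
    have hre0 := ZetaZeros.riemannZetaNontrivialZeros.re_pos ρ.2
    have hre1' := ZetaZeros.riemannZetaNontrivialZeros.re_lt_one ρ.2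
    have him := ZetaZeros.riemannZetaNontrivialZeros.im_ne_zero ρ.2
    have hm : 0 ≤ riemannZetaZeroOrder (ρ : ℂ) :=
      riemannZetaZeroOrder_nonneg (ZetaZeros.riemannZetaNontrivialZeros.ne_one ρ.2)
    have hm' : (0 : ℝ) ≤ riemannZetaZeroOrder (ρ : ℂ) := by exact_mod_cast hm
    have h14ρ : 14 < |(ρ : ℂ).im| := FordL33.fourteen_lt_abs_im ⟨(ρ : ℂ), ρ.2⟩
    have hw14 : screwTailWeight 14 (ρ : ℂ).im = 1 / (ρ : ℂ).im ^ 2 := by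
      simp [screwTailWeight, h14ρ]
    have hA : 0 ≤ 2 * ((riemannZetaZeroOrder (ρ : ℂ) : ℝ) * screwTailWeight 14 (ρ : ℂ).im) :=
      mul_nonneg (by norm_num) (mul_nonneg hm' (screwTailWeight_nonneg _ _))
    have hB : 0 ≤ K * ((riemannZetaZeroOrder (ρ : ℂ) : ℝ) * screwTailWeight H (ρ : ℂ).im) :=
      mul_nonneg hK0 (mul_nonneg hm' (screwTailWeight_nonneg _ _))
    by_cases hρr : ρ = r₀
    · -- the off-line zero itself: exact value
      rw [if_pos hρr]
      have hρ : (ρ : ℂ) = ρ₀ := by rw [hρr]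
      have hval : (screwTerm t ρ).re = E₀ := by
        rw [hρ, hE₀, hF, screwTerm_re_eq_quartet habs₀ rfl hres]
      linarith
    · rw [if_neg hρr, add_zero]
      by_cases hfar : H < |(ρ : ℂ).im|
      · -- unverified height: norm bound
        have hwH : screwTailWeight H (ρ : ℂ).im = 1 / (ρ : ℂ).im ^ 2 := by
          simp [screwTailWeight, hfar]
        have h := screwTerm_re_le hre0.le hre1'.le him hm t
        rw [hwH]
        calc (screwTerm t ρ).re
            ≤ (riemannZetaZeroOrder (ρ : ℂ) : ℝ) * ((1 + Real.cosh (t / 2)) / (ρ : ℂ).im ^ 2) := h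
          _ = K * ((riemannZetaZeroOrder (ρ : ℂ) : ℝ) * (1 / (ρ : ℂ).im ^ 2)) := by
              rw [hK]; ring
          _ ≤ _ := le_add_of_nonneg_left hA
      · rcases hclean _ hz hre0 hre1' (not_lt.1 hfar) with hline | ⟨hq1, hq2⟩
        · -- on the line
          have h := screwTerm_re_le_of_re_eq_half hline him hm t
          rw [hw14]
          calc (screwTerm t ρ).re ≤ (riemannZetaZeroOrder (ρ : ℂ) : ℝ) * (2 / (ρ : ℂ).im ^ 2) := h
            _ = 2 * ((riemannZetaZeroOrder (ρ : ℂ) : ℝ) * (1 / (ρ : ℂ).im ^ 2)) := by ring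
            _ ≤ _ := le_add_of_nonneg_right hB
        · -- another member of the quartet: non-positive
          have h := screwTerm_re_quartet_nonpos hq1 hq2 hres hηγ hm
          linarith
  have hle := hasSum_le hpt h1 h2
  -- assemble
  have hE : E₀ ≤ F := by
    have hF0 : F ≤ 0 := by
      have hc : 0 ≤ Real.cosh (η * t) - 1 := by linarith [Real.one_le_cosh (η * t)]
      have hd : (η ^ 2 - ρ₀.im ^ 2) / (η ^ 2 + ρ₀.im ^ 2) ^ 2 ≤ 0 :=
        div_nonpos_of_nonpos_of_nonneg (by linarith) (by positivity)
      exact mul_nonpos_of_nonneg_of_nonpos hc hd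
    exact mul_le_of_one_le_left hF0 hm₀
  have hS₂' : K * S₂ ≤ K * (64 * C₀ * Real.log (H + 2) / (H + 1)) :=
    mul_le_mul_of_nonneg_left htsumH hK0
  have hFe : F = -((Real.cosh (η * t) - 1) *
      ((ρ₀.im ^ 2 - η ^ 2) / (ρ₀.im ^ 2 + η ^ 2) ^ 2)) := by
    rw [hF, add_comm (η ^ 2) (ρ₀.im ^ 2)]; ring
  rw [hFe] at hE
  linarith

/-- **T44, lone quartet.** If the ONLY off-line zeros of `ζ` are in the quartet `1/2 ± η ± iγ₀`
(cleanliness at every height), the price term disappears: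
`Ψ(2πk/γ₀) ≤ −(cosh(η t) − 1)(γ₀² − η²)/(γ₀² + η²)² + 128·C₀·log 16/15`. -/
theorem zetaScrew_le_of_lone_quartet (hS : Suzuki2023_thm11_series) {C₀ : ℝ} (hC₀ : 0 ≤ C₀)
    (hW : ∀ u : ℝ, (zetaZeroCount (u + 1) : ℝ) - zetaZeroCount u ≤ C₀ * Real.log (|u| + 2))
    {ρ₀ : ℂ} {η : ℝ} (hζ : riemannZeta ρ₀ = 0) (hρ₀ : ρ₀.re = 1 / 2 + η) (hη : 0 < η)
    (hclean : ∀ H : ℝ, RHUpToExcept H η ρ₀.im) (k : ℤ) :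
    zetaScrew (2 * π * k / ρ₀.im) ≤
      -((Real.cosh (η * (2 * π * k / ρ₀.im)) - 1) *
          ((ρ₀.im ^ 2 - η ^ 2) / (ρ₀.im ^ 2 + η ^ 2) ^ 2))
        + 128 * C₀ * Real.log (14 + 2) / (14 + 1) := by
  set t : ℝ := 2 * π * k / ρ₀.im with ht
  set K : ℝ := 1 + Real.cosh (2 * π * k / ρ₀.im / 2) with hK
  have hK0 : 0 < K := by positivity
  refine le_of_forall_pos_lt_add fun ε hε ↦ ?_
  -- the price term tends to `0` as `H → ∞`
  have hlim : Tendsto (fun H : ℝ ↦ K * (64 * C₀ * Real.log (H + 2) / (H + 1))) atTop (𝓝 0) := by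
    have h0 := Real.tendsto_pow_log_div_mul_add_atTop 1 (-1) 1 one_ne_zero
    have h1 : Tendsto (fun H : ℝ ↦ H + 2) atTop atTop := tendsto_atTop_add_const_right _ 2
      tendsto_id
    have h2 := h0.comp h1
    have h3 : Tendsto (fun H : ℝ ↦ K * (64 * C₀) * (Real.log (H + 2) ^ 1 / (1 * (H + 2) + -1)))
        atTop (𝓝 (K * (64 * C₀) * 0)) := h2.const_mul _
    rw [mul_zero] at h3
    refine h3.congr' ?_
    filter_upwards [eventually_ge_atTop (0 : ℝ)] with H hH
    simp only [pow_one]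
    have : 1 * (H + 2) + -1 = H + 1 := by ring
    rw [this]; ring
  obtain ⟨H, hHε, hHγ⟩ := ((hlim.eventually (gt_mem_nhds hε)).and
    (eventually_ge_atTop |ρ₀.im|)).exists
  have h := zetaScrew_le_of_rhUpToExcept hS hC₀ hW hζ hρ₀ hη hHγ (hclean H) k
  rw [← hK] at h
  linarith

/-- **T44, existence form.** Under the lone-quartet hypothesis `Ψ` is negative at some resonant
window — quantitatively from `cosh(η t) − 1 > (128·C₀·log 16/15)(γ₀² + η²)²/(γ₀² − η²)` on,
i.e. `t ≈ η⁻¹ log(C·C₀·γ₀²)`. -/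
theorem exists_zetaScrew_neg_of_lone_quartet (hS : Suzuki2023_thm11_series) {C₀ : ℝ}
    (hC₀ : 0 ≤ C₀)
    (hW : ∀ u : ℝ, (zetaZeroCount (u + 1) : ℝ) - zetaZeroCount u ≤ C₀ * Real.log (|u| + 2))
    {ρ₀ : ℂ} {η : ℝ} (hζ : riemannZeta ρ₀ = 0) (hρ₀ : ρ₀.re = 1 / 2 + η) (hη : 0 < η)
    (hclean : ∀ H : ℝ, RHUpToExcept H η ρ₀.im) : ∃ t : ℝ, zetaScrew t < 0 := by
  -- facts about `ρ₀`
  have hmem₀ : ρ₀ ∈ ZetaZeros.riemannZetaNontrivialZeros :=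
    ZetaZeros.riemannZetaNontrivialZeros.mem_of_re_pos hζ (by rw [hρ₀]; linarith)
  have h14 : 14 < |ρ₀.im| := FordL33.fourteen_lt_abs_im ⟨ρ₀, hmem₀⟩
  have hγpos : 0 < |ρ₀.im| := by linarith
  have hγne : ρ₀.im ≠ 0 := abs_pos.1 hγpos
  have hre1 : ρ₀.re < 1 := ZetaZeros.riemannZetaNontrivialZeros.re_lt_one hmem₀
  have hη1 : η < 1 / 2 := by linarith
  have hD0 : 0 < ρ₀.im ^ 2 - η ^ 2 := by
    rw [← sq_abs ρ₀.im]; nlinarith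
  set B : ℝ := 128 * C₀ * Real.log (14 + 2) / (14 + 1) with hB
  have hB0 : 0 ≤ B := by
    rw [hB]; have : 0 ≤ Real.log (14 + 2) := Real.log_nonneg (by norm_num)
    positivity
  -- the threshold `M` for `cosh(ηt) − 1`
  set M : ℝ := B * ((ρ₀.im ^ 2 + η ^ 2) ^ 2 / (ρ₀.im ^ 2 - η ^ 2)) with hM
  have hM0 : 0 ≤ M := by rw [hM]; positivity
  -- choose `n` with `2πηn/|γ₀| > 2M + 3`
  obtain ⟨n, hn⟩ := exists_nat_gt ((2 * M + 3) * |ρ₀.im| / (2 * π * η))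
  have hπη : 0 < 2 * π * η := by positivity
  have hx : 2 * M + 3 < η * (2 * π * n / |ρ₀.im|) := by
    rw [div_lt_iff₀ hπη] at hn
    rw [mul_div_assoc', lt_div_iff₀ hγpos]
    nlinarith
  -- the resonant window `t = 2πk/γ₀` with `k = ± n` so that `η t = 2πηn/|γ₀| > 0`
  obtain ⟨k, hk⟩ : ∃ k : ℤ, (2 * π * k / ρ₀.im : ℝ) = 2 * π * n / |ρ₀.im| := by
    rcases lt_or_gt_of_ne hγne with hneg | hpos
    · refine ⟨-n, ?_⟩; rw [abs_of_neg hneg]; push_cast; field_simp; try ring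
    · exact ⟨n, by rw [abs_of_pos hpos]; push_cast; ring⟩
  refine ⟨2 * π * k / ρ₀.im, ?_⟩
  have h := zetaScrew_le_of_lone_quartet hS hC₀ hW hζ hρ₀ hη hclean k
  rw [hk] at h ⊢
  set x : ℝ := η * (2 * π * n / |ρ₀.im|) with hxdef
  -- `cosh x − 1 ≥ (x − 1)/2 > M + 1`
  have hcosh : M + 1 < Real.cosh x - 1 := by
    have h1 : x + 1 ≤ Real.exp x := Real.add_one_le_exp x
    have h2 : 0 < Real.exp (-x) := Real.exp_pos _
    rw [Real.cosh_eq]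
    linarith
  -- conclude
  have hq : 0 < (ρ₀.im ^ 2 - η ^ 2) / (ρ₀.im ^ 2 + η ^ 2) ^ 2 := by positivity
  have hkey : B < (Real.cosh x - 1) * ((ρ₀.im ^ 2 - η ^ 2) / (ρ₀.im ^ 2 + η ^ 2) ^ 2) := by
    have hMq : M * ((ρ₀.im ^ 2 - η ^ 2) / (ρ₀.im ^ 2 + η ^ 2) ^ 2) = B := by
      rw [hM]; field_simp
    calc B = M * ((ρ₀.im ^ 2 - η ^ 2) / (ρ₀.im ^ 2 + η ^ 2) ^ 2) := hMq.symm
      _ < (Real.cosh x - 1) * ((ρ₀.im ^ 2 - η ^ 2) / (ρ₀.im ^ 2 + η ^ 2) ^ 2) := by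
          apply mul_lt_mul_of_pos_right _ hq; linarith
  linarith

end Summit.RiemannHypothesis.RiemannHypothesis.Theorems

end
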